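import Summits.BirchSwinnertonDyer.Rank1Residual.Additive.TameBranchOneValueStickelberger
import HarnessLib

/-!
# The TWO-VALUE LAW: two wild twisted symbol sums at CONSECUTIVE conductors `p^{n+1+e₀}`,
# `p^{n+2+e₀}` decide BOTH `λ_an` AND the character — the crossed reading of a starred value is
# refuted by the next level (cell `b2b-bsdres`, sub-cell additive-p2 = X3♯(G-ord)/X4♯(G-ord), gen 28;
# part 1/3)

HONEST FRAMING (cell `b2b-bsdres`, run/shared/lean/b2b/bsd-rank1-residual/, verbatim in every
file): the goal of the cell is to DELETE the COMBINATION-SHAPED residual classes of the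
Birch–Swinnerton-Dyer formula for ALL analytic-rank `≤ 1` elliptic curves over `ℚ` — "full BSD
formula for every rank `≤ 1` curve in class `C`" assembled STRICTLY from published theorems — so
that the rank-`≤ 1` remainder becomes exactly the CONSTRUCTION-SHAPED classes, which are TYPED
(missing-input `Prop`s), NOT attempted. This is not "finishing BSD". Sub-cell additive-p2: the
classes X3♯(G-ord) / X4♯(G-ord) are CONSTRUCTION-SHAPED and stay so; labels / RESIDUAL-MAP marks
UNCHANGED; nothing is booked. THEOREMS ONLY (pure `p`-adic algebra + the interpolation row of
cc-typer-2's `IsTameBranchOf` + Stickelberger); no definition, no named fact, no `sorry`.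

## What and why

Gen 27 (`TameBranchOneValueStickelberger.lean`) proved the ONE-VALUE LAW both ways: for EVERY
witness `B` of `IsTameBranchOf f p (ι∘χ₀) α B` with coefficient bound `p^c` and first top coefficient
at `k`, and every even primitive `p`-power-order `κ` of conductor `p^{n+1+e₀}` (`φ = φ(pⁿ⁺¹)`, `k < φ`),
`ord_p S(κ) = k/φ + 1/e − c` if `χ₀ = ω^u` (small exponent; UNSTARRED Kodaira types) and
`= k/φ + 1 − 1/e − c` if `χ₀ = ω^{(e−1)u} = ω^{−u}` (STARRED types), where
`S(κ) = Σ_b κ(b)[b/p^{n+1+e₀}]⁺_f` is CHARACTER-FREE. On unstarred rows ONE value decides the sign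
too (gen 27 `lt_mul_norm_tameGaussSum_inv_mul_norm_of_pow_eq`: the starred reading of an unstarred
value exceeds the Gauss bound). On STARRED rows one value does NOT: the starred value with
parameter `k` IS the unstarred value with parameter `k + (e−2)·u·pⁿ` (§3 below; real data: at `p = 5`,
`e = 4`, conductor `p²` the III row 175a1 (`λ_an = 3`) and the III* row 10725e1 (`λ_an = 1`) have the
SAME valuation `ord_5 S(κ₁) = 1` — HOME/b2b-bsdres-additive-p2/gen26/GAUSSCERT-CHECK.md). This file
proves that the NEXT conductor resolves it:

* §1 arithmetic of the layer (`φ(pⁿ⁺¹) = e·(pⁿ·u)` when `eu = p − 1`; the exponent identity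
  `e·k + (e−1)·φ = e·(k + (e−2)·pⁿ·u) + φ`) and **uniqueness of the first top coefficient**
  (`firstTop_unique`);
* §2 the STARRED law and certificate in INVERSE form (witness character `ι∘χ⁻¹` for `χ = ω^u` — the
  shape in which Delbourgo 1998 Thm 1's dichotomy `χ₀ ∈ {χ, χ⁻¹}` delivers it):
  `IsTameBranchOf.norm_ratTwistedSymbolSum_pow_eq_of_firstTop_inv`,
  **`IsTameBranchOf.firstTop_of_norm_ratTwistedSymbolSum_pow_eq_inv`**;
* §3 **THE CROSSED READING** `IsTameBranchOf.firstTop_add_of_norm_ratTwistedSymbolSum_pow_eq`: an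
  UNSTARRED witness (`ι∘χ`, `χ = ω^u`) whose value lies on the STARRED line with parameter `k`,
  `e·k < 2φ`, has its first top coefficient at `k + (e−2)·pⁿ·u` — a LEVEL-DEPENDENT index;
* §4 **TWO LEVELS REFUTE IT** `IsTameBranchOf.false_of_norm_ratTwistedSymbolSum_pow_eq_succ`: the
  same witness cannot have its values on the starred line with the same `k` at conductors
  `p^{n+1+e₀}` AND `p^{n+2+e₀}` (`e ≥ 3`: the two indices differ by `(e−2)·u·pⁿ·(p−1) ≠ 0`); and the
  mirror `IsTameBranchOf.false_of_norm_ratTwistedSymbolSum_pow_eq_inv` (a STARRED witness `ι∘χ⁻¹`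
  with a value on the UNSTARRED line, `e·k < (e−2)φ`, contradicts the Gauss bound — gen 27's sign
  lemma packaged with gen 26's `IsTameBranchOf.mul_norm_tameGaussSum_mul_norm_le`).
  Part 2 (`TameBranchTwoValueCertificateJoin.lean`) turns this into: Delbourgo 1998 Thm 1 + 2002 (C)
  + TWO values on ONE line ⟹ `CharLamLeAt W p k` and the sign, TYPE-FREE; part 3 the class forms.

Not claimed: which Teichmüller power is bounded on which Kodaira type (census dictionary, EVIDENCE);
anything about `μ` of `char_Λ X`; any booking.

References: Lang, *Cyclotomic Fields I–II*, Ch. 1 §2 Thm. 2.1 (Stickelberger) [Lang1990];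
Mazur–Tate–Teitelbaum 1986 §I.8, §I.13–I.14 [MazurTateTeitelbaum1986Invent]; Washington GTM 83
§7.1–7.2 [Washington1997]; HOME/b2b-bsdres-additive-p2/gen26/GAUSSCERT-CHECK.md, GAUSSCERT3-RESULT.md,
gen28/TWO-VALUE-READING.md (evidence this file explains). -/

set_option autoImplicit false

noncomputable section

open scoped Classical MatrixGroups ModularForm NumberField Topology

open CongruenceSubgroup IsDedekindDomain WeierstrassCurve NumberField Filter
  Literature.NumberTheory.EllipticCurves
  Literature.NumberTheory.EllipticCurves.ModularForms
  Literature.NumberTheory.EllipticCurves.Rank1Residual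
  Literature.NumberTheory.GaussSums

namespace Summit.BirchSwinnertonDyer.Rank1Residual.Additive

/-! ### §1 Arithmetic of the layer and uniqueness of the first top coefficient -/

namespace TameBranchTwoValue

section Arith

variable {p : ℕ} [hp : Fact p.Prime]

/-- `φ(pⁿ⁺¹) = e·(pⁿ·u)` when `e·u = p − 1`. [folklore] -/
theorem totient_prime_pow_succ_eq_mul {e u : ℕ} (hu : e * u = p - 1) (n : ℕ) :
    Nat.totient (p ^ (n + 1)) = e * (p ^ n * u) := by
  rw [Nat.totient_prime_pow_succ hp.out, ← hu]; ring

omit hp in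
/-- The exponent identity behind the crossed reading: with `φ = e·d` and `e ≥ 2`,
`e·k + (e−1)·φ = e·(k + (e−2)·d) + φ`. [folklore] -/
theorem mul_add_sub_one_mul_eq {e k d : ℕ} (h2 : 2 ≤ e) :
    e * k + (e - 1) * (e * d) = e * (k + (e - 2) * d) + e * d := by
  obtain ⟨e', rfl⟩ : ∃ e', e = e' + 2 := ⟨e - 2, by omega⟩
  simp only [Nat.add_sub_cancel, show e' + 2 - 1 = e' + 1 by omega]
  ring

omit hp in
/-- The crossed index stays below `φ`: `e·k < 2·(e·d)`, `e ≥ 2` ⟹ `k + (e−2)·d < e·d`. [folklore] -/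
theorem add_sub_two_mul_lt {e k d : ℕ} (h2 : 2 ≤ e) (hk : e * k < 2 * (e * d)) :
    k + (e - 2) * d < e * d := by
  obtain ⟨e', rfl⟩ : ∃ e', e = e' + 2 := ⟨e - 2, by omega⟩
  simp only [Nat.add_sub_cancel]
  have hk' : k < 2 * d := by
    by_contra hle
    rw [not_lt] at hle
    have : 2 * ((e' + 2) * d) ≤ (e' + 2) * k := by
      calc 2 * ((e' + 2) * d) = (e' + 2) * (2 * d) := by ring
        _ ≤ (e' + 2) * k := Nat.mul_le_mul_left _ hle
    omega
  nlinarith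

omit hp in
/-- `e·k < 2·φ`, `2 ≤ e` ⟹ `k < φ`. [folklore] -/
theorem lt_of_mul_lt_two_mul {e k φ : ℕ} (h2 : 2 ≤ e) (hk : e * k < 2 * φ) : k < φ := by
  by_contra hle
  rw [not_lt] at hle
  have : 2 * φ ≤ e * k := le_trans (Nat.mul_le_mul_right _ h2) (Nat.mul_le_mul_left _ hle)
  omega

end Arith

section Unique

variable {p : ℕ} [hp : Fact p.Prime]

/-- **The first top coefficient is unique**: if `‖[T^k]B‖ = M` with all earlier coefficients `< M`,
and likewise at `k'`, then `k = k'`. [folklore] -/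
theorem firstTop_unique {B : PowerSeries ℚ_[p]} {M : ℝ} {k k' : ℕ}
    (hk : ‖PowerSeries.coeff k B‖ = M) (hlt : ∀ i < k, ‖PowerSeries.coeff i B‖ < M)
    (hk' : ‖PowerSeries.coeff k' B‖ = M) (hlt' : ∀ i < k', ‖PowerSeries.coeff i B‖ < M) :
    k = k' := by
  by_contra hne
  rcases lt_or_gt_of_ne hne with h | h
  · exact absurd hk (hlt' k h).ne
  · exact absurd hk' (hlt k' h).ne

end Unique

end TameBranchTwoValue

/-! ### §2 The starred law and certificate in inverse form (witness character `ι∘χ⁻¹`, `χ = ω^u`) -/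

section Inverse

open TameBranchOneValue TameBranchTwoValue

variable {p : ℕ} [hp : Fact p.Prime] {N : ℕ} {f : CuspForm (Gamma0 N) 2}

/-- **THE LAW, STARRED, inverse form: `ord_p S(κ) = λ_an/φ(pⁿ⁺¹) + 1 − 1/e − c`.** For `χ = ω^u`
the Teichmüller power of the small exponent (order `e ≥ 2`, `eu = p − 1`), EVERY witness `B` of
`IsTameBranchOf f p (ι∘χ⁻¹) α B` (`‖α‖ = 1`, coefficient bound `p^c`, first top coefficient at `k`) and
every even primitive `p`-power-order `κ` of conductor `p^{n+1+e₀}` with `k < φ(pⁿ⁺¹)`: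
**`‖Σ_b κ(b)[b/p^{n+1+e₀}]⁺_f‖^{e·φ} = (p^c)^{e·φ}·p^{−(e·k + (e−1)·φ)}`** (`‖τ(ι∘χ⁻¹,ψ_κ)‖^e = p⁻¹`).
[cite: Lang1990, Ch. 1 §2 Thm. 2.1] [cite: MazurTateTeitelbaum1986Invent, §I.8, §I.13–I.14]
[cite: Washington1997, §7.1–7.2 (shape)] -/
theorem IsTameBranchOf.norm_ratTwistedSymbolSum_pow_eq_of_firstTop_inv
    {χ : MulChar (ZMod p) ℚ_[p]} {α : ℚ_[p]} {B : PowerSeries ℚ_[p]}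
    (h : IsTameBranchOf f p (χ⁻¹.ringHomComp (algebraMap ℚ_[p] ℂ_[p])) α B) (hα : ‖α‖ = 1) {c : ℕ}
    (hbd : ∀ j : ℕ, ‖PowerSeries.coeff j B‖ ≤ (p : ℝ) ^ c)
    {k : ℕ} (hk : ‖PowerSeries.coeff k B‖ = (p : ℝ) ^ c)
    (hlt : ∀ i < k, ‖PowerSeries.coeff i B‖ < (p : ℝ) ^ c)
    {u e : ℕ} (hteich : ∀ a : ZMod p, a ≠ 0 → ‖χ a - ((a.val : ℕ) : ℚ_[p]) ^ u‖ < 1)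
    (hχe : orderOf χ = e) (h2 : 2 ≤ e) (hu : e * u = p - 1)
    {n : ℕ} {κ : DirichletCharacter ℂ_[p] (p ^ (n + 1 + cyclotomicExponent p))} (hκ : κ.IsPrimitive)
    (heven : κ.Even) (hord : ∃ j : ℕ, orderOf κ = p ^ j) (hkφ : k < Nat.totient (p ^ (n + 1))) :
    ‖ratTwistedSymbolSum f κ‖ ^ (e * Nat.totient (p ^ (n + 1))) =
      ((p : ℝ) ^ c) ^ (e * Nat.totient (p ^ (n + 1))) *
        ((p : ℝ)⁻¹) ^ (e * k + (e - 1) * Nat.totient (p ^ (n + 1))) := by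
  have hp0 : (p : ℝ) ≠ 0 := Nat.cast_ne_zero.mpr hp.out.ne_zero
  set φ := Nat.totient (p ^ (n + 1)) with hφ_def
  set T := ‖tameGaussSum p (χ⁻¹.ringHomComp (algebraMap ℚ_[p] ℂ_[p])) κ‖ with hT_def
  set S := ‖ratTwistedSymbolSum f κ‖ with hS_def
  have hX := h.pow_totient_eq_of_firstTop hα hbd hk hlt hκ heven hord hkφ
  have hτ := norm_tameGaussSum_inv_pow_eq_of_teichmullerPow hteich hχe h2 hu
    (two_le_add_one_add_cyclotomicExponent n) hκ
  -- `X^e = p^e · p⁻¹ · S^e = p^{e−1} S^e`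
  have hXe : ((p : ℝ) * T * S) ^ e = (p : ℝ) ^ (e - 1) * S ^ e := by
    rw [mul_pow, mul_pow, hT_def, hτ, pow_mul_inv_eq_pow_sub_one (by omega)]
  have h1 : ((p : ℝ) * T * S) ^ (e * φ) = (p : ℝ) ^ ((e - 1) * φ) * S ^ (e * φ) := by
    rw [pow_mul, hXe, mul_pow, ← pow_mul, ← pow_mul]
  have h2' : ((p : ℝ) * T * S) ^ (e * φ) = ((p : ℝ) ^ c) ^ (e * φ) * ((p : ℝ)⁻¹) ^ (e * k) := by
    rw [mul_comm e φ, pow_mul, hX]; ring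
  have hpφ : (p : ℝ) ^ ((e - 1) * φ) ≠ 0 := pow_ne_zero _ hp0
  calc S ^ (e * φ) = ((p : ℝ) ^ ((e - 1) * φ))⁻¹ * ((p : ℝ) ^ ((e - 1) * φ) * S ^ (e * φ)) := by
        rw [inv_mul_cancel_left₀ hpφ]
    _ = ((p : ℝ) ^ ((e - 1) * φ))⁻¹ * (((p : ℝ) ^ c) ^ (e * φ) * ((p : ℝ)⁻¹) ^ (e * k)) := by
        rw [← h1, h2']
    _ = ((p : ℝ) ^ c) ^ (e * φ) * ((p : ℝ)⁻¹) ^ (e * k + (e - 1) * φ) := by rw [← inv_pow]; ring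

/-- **THE CERTIFICATE, STARRED, inverse form.** `χ = ω^u` (small exponent, order `e ≥ 2`,
`eu = p − 1`), EVERY witness `B` of `IsTameBranchOf f p (ι∘χ⁻¹) α B` (`‖α‖ = 1`, bound `p^c`), ONE even
primitive `p`-power-order `κ` of conductor `p^{n+1+e₀}` and `k < φ(pⁿ⁺¹)` with
**`‖Σ_b κ(b)[b/p^{n+1+e₀}]⁺_f‖^{e·φ} = (p^c)^{e·φ}·p^{−(e·k + (e−1)·φ)}`** ⟹ **`‖[T^k]B‖ = p^c`, all
earlier coefficients `< p^c`**. [cite: Lang1990, Ch. 1 §2 Thm. 2.1]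
[cite: MazurTateTeitelbaum1986Invent, §I.8, §I.13–I.14] [cite: Washington1997, §7.1–7.2 (shape)] -/
theorem IsTameBranchOf.firstTop_of_norm_ratTwistedSymbolSum_pow_eq_inv
    {χ : MulChar (ZMod p) ℚ_[p]} {α : ℚ_[p]} {B : PowerSeries ℚ_[p]}
    (h : IsTameBranchOf f p (χ⁻¹.ringHomComp (algebraMap ℚ_[p] ℂ_[p])) α B) (hα : ‖α‖ = 1) {c : ℕ}
    (hbd : ∀ j : ℕ, ‖PowerSeries.coeff j B‖ ≤ (p : ℝ) ^ c)
    {u e : ℕ} (hteich : ∀ a : ZMod p, a ≠ 0 → ‖χ a - ((a.val : ℕ) : ℚ_[p]) ^ u‖ < 1)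
    (hχe : orderOf χ = e) (h2 : 2 ≤ e) (hu : e * u = p - 1)
    {n : ℕ} {κ : DirichletCharacter ℂ_[p] (p ^ (n + 1 + cyclotomicExponent p))} (hκ : κ.IsPrimitive)
    (heven : κ.Even) (hord : ∃ j : ℕ, orderOf κ = p ^ j) {k : ℕ} (hkφ : k < Nat.totient (p ^ (n + 1)))
    (hval : ‖ratTwistedSymbolSum f κ‖ ^ (e * Nat.totient (p ^ (n + 1))) =
      ((p : ℝ) ^ c) ^ (e * Nat.totient (p ^ (n + 1))) *
        ((p : ℝ)⁻¹) ^ (e * k + (e - 1) * Nat.totient (p ^ (n + 1)))) :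
    ‖PowerSeries.coeff k B‖ = (p : ℝ) ^ c ∧ ∀ i < k, ‖PowerSeries.coeff i B‖ < (p : ℝ) ^ c := by
  have hp0 : (p : ℝ) ≠ 0 := Nat.cast_ne_zero.mpr hp.out.ne_zero
  set φ := Nat.totient (p ^ (n + 1)) with hφ_def
  set T := ‖tameGaussSum p (χ⁻¹.ringHomComp (algebraMap ℚ_[p] ℂ_[p])) κ‖ with hT_def
  set S := ‖ratTwistedSymbolSum f κ‖ with hS_def
  have hτ := norm_tameGaussSum_inv_pow_eq_of_teichmullerPow hteich hχe h2 hu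
    (two_le_add_one_add_cyclotomicExponent n) hκ
  have hXe : ((p : ℝ) * T * S) ^ e = (p : ℝ) ^ (e - 1) * S ^ e := by
    rw [mul_pow, mul_pow, hT_def, hτ, pow_mul_inv_eq_pow_sub_one (by omega)]
  have h1 : ((p : ℝ) * T * S) ^ (e * φ) = (p : ℝ) ^ ((e - 1) * φ) * S ^ (e * φ) := by
    rw [pow_mul, hXe, mul_pow, ← pow_mul, ← pow_mul]
  have hXφ : (((p : ℝ) * T * S) ^ φ) ^ e = (((p : ℝ) ^ c) ^ φ * ((p : ℝ)⁻¹) ^ k) ^ e := by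
    rw [← pow_mul, mul_comm φ e, h1, hval]
    have hc1 : (p : ℝ) ^ ((e - 1) * φ) * ((p : ℝ)⁻¹) ^ ((e - 1) * φ) = 1 := by
      rw [← mul_pow, mul_inv_cancel₀ hp0, one_pow]
    calc (p : ℝ) ^ ((e - 1) * φ) * (((p : ℝ) ^ c) ^ (e * φ) * ((p : ℝ)⁻¹) ^ (e * k + (e - 1) * φ))
        = ((p : ℝ) ^ ((e - 1) * φ) * ((p : ℝ)⁻¹) ^ ((e - 1) * φ)) *
            (((p : ℝ) ^ c) ^ (e * φ) * ((p : ℝ)⁻¹) ^ (e * k)) := by ring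
      _ = (((p : ℝ) ^ c) ^ φ * ((p : ℝ)⁻¹) ^ k) ^ e := by rw [hc1, one_mul]; ring
  have hval' : ((p : ℝ) * T * S) ^ φ = ((p : ℝ) ^ c) ^ φ * ((p : ℝ)⁻¹) ^ k :=
    (pow_left_inj₀ (by positivity) (by positivity) (by omega : e ≠ 0)).mp hXφ
  exact h.firstTop_of_pow_totient_eq hα hbd hκ heven hord hkφ hval'

end Inverse

/-! ### §3 The crossed reading: an unstarred witness whose value lies on the starred line -/

section Crossed

open TameBranchOneValue TameBranchTwoValue

variable {p : ℕ} [hp : Fact p.Prime] {N : ℕ} {f : CuspForm (Gamma0 N) 2}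

/-- **THE CROSSED READING.** `χ = ω^u` (small exponent, order `e ≥ 2`, `eu = p − 1`), a witness `B` of
`IsTameBranchOf f p (ι∘χ) α B` (`‖α‖ = 1`, bound `p^c`), ONE even primitive `p`-power-order `κ` of
conductor `p^{n+1+e₀}` whose value lies on the STARRED line with parameter `k`,
**`‖S(κ)‖^{e·φ} = (p^c)^{e·φ}·p^{−(e·k + (e−1)·φ)}`**, and **`e·k < 2·φ(pⁿ⁺¹)`**. Then the first top
coefficient of `B` sits at the LEVEL-DEPENDENT index **`k + (e−2)·pⁿ·u`** (`< φ`): the starred value with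
parameter `k` IS the unstarred value with parameter `k + (e−2)φ/e`. [cite: Lang1990, Ch. 1 §2 Thm. 2.1]
[cite: MazurTateTeitelbaum1986Invent, §I.8, §I.13–I.14] [cite: Washington1997, §7.1–7.2 (shape)] -/
theorem IsTameBranchOf.firstTop_add_of_norm_ratTwistedSymbolSum_pow_eq
    {χ : MulChar (ZMod p) ℚ_[p]} {α : ℚ_[p]} {B : PowerSeries ℚ_[p]}
    (h : IsTameBranchOf f p (χ.ringHomComp (algebraMap ℚ_[p] ℂ_[p])) α B) (hα : ‖α‖ = 1) {c : ℕ}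
    (hbd : ∀ j : ℕ, ‖PowerSeries.coeff j B‖ ≤ (p : ℝ) ^ c)
    {u e : ℕ} (hteich : ∀ a : ZMod p, a ≠ 0 → ‖χ a - ((a.val : ℕ) : ℚ_[p]) ^ u‖ < 1)
    (hχe : orderOf χ = e) (h2 : 2 ≤ e) (hu : e * u = p - 1)
    {n : ℕ} {κ : DirichletCharacter ℂ_[p] (p ^ (n + 1 + cyclotomicExponent p))} (hκ : κ.IsPrimitive)
    (heven : κ.Even) (hord : ∃ j : ℕ, orderOf κ = p ^ j) {k : ℕ}
    (hk2 : e * k < 2 * Nat.totient (p ^ (n + 1)))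
    (hval : ‖ratTwistedSymbolSum f κ‖ ^ (e * Nat.totient (p ^ (n + 1))) =
      ((p : ℝ) ^ c) ^ (e * Nat.totient (p ^ (n + 1))) *
        ((p : ℝ)⁻¹) ^ (e * k + (e - 1) * Nat.totient (p ^ (n + 1)))) :
    ‖PowerSeries.coeff (k + (e - 2) * (p ^ n * u)) B‖ = (p : ℝ) ^ c ∧
      ∀ i < k + (e - 2) * (p ^ n * u), ‖PowerSeries.coeff i B‖ < (p : ℝ) ^ c := by
  have hφ : Nat.totient (p ^ (n + 1)) = e * (p ^ n * u) := totient_prime_pow_succ_eq_mul hu n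
  have hK : k + (e - 2) * (p ^ n * u) < Nat.totient (p ^ (n + 1)) := by
    rw [hφ] at hk2 ⊢; exact add_sub_two_mul_lt h2 hk2
  refine h.firstTop_of_norm_ratTwistedSymbolSum_pow_eq hα hbd hteich hχe h2 hu hκ heven hord hK ?_
  rw [hval]
  congr 1
  conv_lhs => rw [hφ, mul_add_sub_one_mul_eq h2, ← hφ]

end Crossed

/-! ### §4 Two consecutive conductors refute the crossed reading; the mirror case -/

section TwoLevels

open TameBranchOneValue TameBranchTwoValue

variable {p : ℕ} [hp : Fact p.Prime] {N : ℕ} {f : CuspForm (Gamma0 N) 2}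

/-- `e·k < 2·φ(pⁿ⁺¹) ⟹ e·k < 2·φ(pⁿ⁺²)`. [folklore] -/
theorem mul_lt_two_mul_totient_succ {e k n : ℕ} (hk2 : e * k < 2 * Nat.totient (p ^ (n + 1))) :
    e * k < 2 * Nat.totient (p ^ (n + 1 + 1)) := by
  have hle : Nat.totient (p ^ (n + 1)) ≤ Nat.totient (p ^ (n + 1 + 1)) := by
    rw [Nat.totient_prime_pow_succ hp.out, Nat.totient_prime_pow_succ hp.out]
    exact Nat.mul_le_mul_right _ (Nat.pow_le_pow_right hp.out.pos (Nat.le_succ n))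
  omega

/-- **TWO CONSECUTIVE CONDUCTORS REFUTE THE CROSSED READING.** `χ = ω^u` (small exponent, order
`e ≥ 3`, `eu = p − 1`), a witness `B` of `IsTameBranchOf f p (ι∘χ) α B` (`‖α‖ = 1`, bound `p^c`), even
primitive `p`-power-order `κ` of conductor `p^{n+1+e₀}` and `κ'` of conductor `p^{n+2+e₀}`, and `k` with
`e·k < 2·φ(pⁿ⁺¹)`. The two values CANNOT both lie on the starred line with parameter `k`
(`‖S(κ)‖^{e·φₙ} = (p^c)^{e·φₙ}·p^{−(e·k+(e−1)φₙ)}` and the same at level `n+1`): §3 would put the first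
top coefficient at `k + (e−2)·u·pⁿ` AND at `k + (e−2)·u·pⁿ⁺¹`. [cite: Lang1990, Ch. 1 §2 Thm. 2.1]
[cite: MazurTateTeitelbaum1986Invent, §I.8, §I.13–I.14] [cite: Washington1997, §7.1–7.2 (shape)] -/
theorem IsTameBranchOf.false_of_norm_ratTwistedSymbolSum_pow_eq_succ
    {χ : MulChar (ZMod p) ℚ_[p]} {α : ℚ_[p]} {B : PowerSeries ℚ_[p]}
    (h : IsTameBranchOf f p (χ.ringHomComp (algebraMap ℚ_[p] ℂ_[p])) α B) (hα : ‖α‖ = 1) {c : ℕ}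
    (hbd : ∀ j : ℕ, ‖PowerSeries.coeff j B‖ ≤ (p : ℝ) ^ c)
    {u e : ℕ} (hteich : ∀ a : ZMod p, a ≠ 0 → ‖χ a - ((a.val : ℕ) : ℚ_[p]) ^ u‖ < 1)
    (hχe : orderOf χ = e) (h3 : 3 ≤ e) (hu : e * u = p - 1)
    {n : ℕ} {κ : DirichletCharacter ℂ_[p] (p ^ (n + 1 + cyclotomicExponent p))} (hκ : κ.IsPrimitive)
    (heven : κ.Even) (hord : ∃ j : ℕ, orderOf κ = p ^ j)
    {κ' : DirichletCharacter ℂ_[p] (p ^ (n + 1 + 1 + cyclotomicExponent p))} (hκ' : κ'.IsPrimitive)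
    (heven' : κ'.Even) (hord' : ∃ j : ℕ, orderOf κ' = p ^ j) {k : ℕ}
    (hk2 : e * k < 2 * Nat.totient (p ^ (n + 1)))
    (hval : ‖ratTwistedSymbolSum f κ‖ ^ (e * Nat.totient (p ^ (n + 1))) =
      ((p : ℝ) ^ c) ^ (e * Nat.totient (p ^ (n + 1))) *
        ((p : ℝ)⁻¹) ^ (e * k + (e - 1) * Nat.totient (p ^ (n + 1))))
    (hval' : ‖ratTwistedSymbolSum f κ'‖ ^ (e * Nat.totient (p ^ (n + 1 + 1))) =
      ((p : ℝ) ^ c) ^ (e * Nat.totient (p ^ (n + 1 + 1))) *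
        ((p : ℝ)⁻¹) ^ (e * k + (e - 1) * Nat.totient (p ^ (n + 1 + 1)))) :
    False := by
  have h2 : 2 ≤ e := by omega
  obtain ⟨hK, hltK⟩ := h.firstTop_add_of_norm_ratTwistedSymbolSum_pow_eq hα hbd hteich hχe h2 hu hκ
    heven hord hk2 hval
  obtain ⟨hK', hltK'⟩ := h.firstTop_add_of_norm_ratTwistedSymbolSum_pow_eq hα hbd hteich hχe h2 hu hκ'
    heven' hord' (mul_lt_two_mul_totient_succ hk2) hval'
  have heq := firstTop_unique hK hltK hK' hltK'
  -- `(e−2)·u·pⁿ < (e−2)·u·pⁿ⁺¹`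
  have hu0 : 0 < u := by
    rcases Nat.eq_zero_or_pos u with h0 | h0
    · rw [h0, mul_zero] at hu; have := hp.out.two_le; omega
    · exact h0
  have hpn : p ^ n * u < p ^ (n + 1) * u :=
    mul_lt_mul_of_pos_right (Nat.pow_lt_pow_right hp.out.one_lt (Nat.lt_succ_self n)) hu0
  have hlt : (e - 2) * (p ^ n * u) < (e - 2) * (p ^ (n + 1) * u) :=
    mul_lt_mul_of_pos_left hpn (by omega)
  omega

/-- **The mirror case: a STARRED witness with a value on the UNSTARRED line.** `χ = ω^u` (small
exponent, order `e ≥ 2`, `eu = p − 1`), a witness of `IsTameBranchOf f p (ι∘χ⁻¹) α B` (`‖α‖ = 1`, bound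
`p^c`), ONE even primitive `p`-power-order `κ` of conductor `p^{n+1+e₀}` with
`‖S(κ)‖^{e·φ} = (p^c)^{e·φ}·p^{−(e·k + φ)}` and `e·k < (e−2)·φ(pⁿ⁺¹)` ⟹ `False` (the value exceeds the
Gauss bound `p‖τ(ι∘χ⁻¹,ψ_κ)‖‖S(κ)‖ ≤ p^c` of the witness — gen 27's sign lemma + gen 26's bound).
[cite: Lang1990, Ch. 1 §2 Thm. 2.1] [cite: MazurTateTeitelbaum1986Invent, §I.8, §I.14] -/
theorem IsTameBranchOf.false_of_norm_ratTwistedSymbolSum_pow_eq_inv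
    {χ : MulChar (ZMod p) ℚ_[p]} {α : ℚ_[p]} {B : PowerSeries ℚ_[p]}
    (h : IsTameBranchOf f p (χ⁻¹.ringHomComp (algebraMap ℚ_[p] ℂ_[p])) α B) (hα : ‖α‖ = 1) {c : ℕ}
    (hbd : ∀ j : ℕ, ‖PowerSeries.coeff j B‖ ≤ (p : ℝ) ^ c)
    {u e : ℕ} (hteich : ∀ a : ZMod p, a ≠ 0 → ‖χ a - ((a.val : ℕ) : ℚ_[p]) ^ u‖ < 1)
    (hχe : orderOf χ = e) (h2 : 2 ≤ e) (hu : e * u = p - 1)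
    {n : ℕ} {κ : DirichletCharacter ℂ_[p] (p ^ (n + 1 + cyclotomicExponent p))} (hκ : κ.IsPrimitive)
    (heven : κ.Even) (hord : ∃ j : ℕ, orderOf κ = p ^ j) {k : ℕ}
    (hke : e * k < (e - 2) * Nat.totient (p ^ (n + 1)))
    (hval : ‖ratTwistedSymbolSum f κ‖ ^ (e * Nat.totient (p ^ (n + 1))) =
      ((p : ℝ) ^ c) ^ (e * Nat.totient (p ^ (n + 1))) *
        ((p : ℝ)⁻¹) ^ (e * k + Nat.totient (p ^ (n + 1)))) :
    False := by
  have hlt := lt_mul_norm_tameGaussSum_inv_mul_norm_of_pow_eq (f := f) hteich hχe h2 hu hκ hke hval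
  have hle := h.mul_norm_tameGaussSum_mul_norm_le hα hbd (two_le_add_one_add_cyclotomicExponent n)
    hκ heven hord
  exact (lt_irrefl _) (hlt.trans_le hle)

/-- `e·k < 2·φ(pⁿ⁺¹)`, `3 ≤ e`, `2 ≤ p` ⟹ `e·k < (e−2)·φ(pⁿ⁺²)` — at the NEXT conductor the mirror
case needs no side condition beyond the two-value one. [folklore] -/
theorem mul_lt_sub_two_mul_totient_succ {e k n : ℕ} (h3 : 3 ≤ e)
    (hk2 : e * k < 2 * Nat.totient (p ^ (n + 1))) :
    e * k < (e - 2) * Nat.totient (p ^ (n + 1 + 1)) := by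
  have hp2 := hp.out.two_le
  have hφ : Nat.totient (p ^ (n + 1 + 1)) = p * Nat.totient (p ^ (n + 1)) := by
    rw [Nat.totient_prime_pow_succ hp.out, Nat.totient_prime_pow_succ hp.out, pow_succ]; ring
  rw [hφ]
  calc e * k < 2 * Nat.totient (p ^ (n + 1)) := hk2
    _ = 1 * (2 * Nat.totient (p ^ (n + 1))) := (one_mul _).symm
    _ ≤ (e - 2) * (p * Nat.totient (p ^ (n + 1))) :=
        Nat.mul_le_mul (by omega) (Nat.mul_le_mul_right _ hp2)

/-- **The mirror case at the next conductor**: `χ = ω^u` (order `e ≥ 3`, `eu = p − 1`), a witness of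
`IsTameBranchOf f p (ι∘χ⁻¹) α B` with bound `p^c`, an even primitive `p`-power-order `κ'` of conductor
`p^{n+2+e₀}` whose value lies on the UNSTARRED line with parameter `k`, and `e·k < 2·φ(pⁿ⁺¹)` ⟹
`False`. [cite: Lang1990, Ch. 1 §2 Thm. 2.1] [cite: MazurTateTeitelbaum1986Invent, §I.8, §I.14] -/
theorem IsTameBranchOf.false_of_norm_ratTwistedSymbolSum_pow_eq_inv_succ
    {χ : MulChar (ZMod p) ℚ_[p]} {α : ℚ_[p]} {B : PowerSeries ℚ_[p]}
    (h : IsTameBranchOf f p (χ⁻¹.ringHomComp (algebraMap ℚ_[p] ℂ_[p])) α B) (hα : ‖α‖ = 1) {c : ℕ}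
    (hbd : ∀ j : ℕ, ‖PowerSeries.coeff j B‖ ≤ (p : ℝ) ^ c)
    {u e : ℕ} (hteich : ∀ a : ZMod p, a ≠ 0 → ‖χ a - ((a.val : ℕ) : ℚ_[p]) ^ u‖ < 1)
    (hχe : orderOf χ = e) (h3 : 3 ≤ e) (hu : e * u = p - 1)
    {n : ℕ} {κ' : DirichletCharacter ℂ_[p] (p ^ (n + 1 + 1 + cyclotomicExponent p))}
    (hκ' : κ'.IsPrimitive) (heven' : κ'.Even) (hord' : ∃ j : ℕ, orderOf κ' = p ^ j) {k : ℕ}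
    (hk2 : e * k < 2 * Nat.totient (p ^ (n + 1)))
    (hval' : ‖ratTwistedSymbolSum f κ'‖ ^ (e * Nat.totient (p ^ (n + 1 + 1))) =
      ((p : ℝ) ^ c) ^ (e * Nat.totient (p ^ (n + 1 + 1))) *
        ((p : ℝ)⁻¹) ^ (e * k + Nat.totient (p ^ (n + 1 + 1)))) :
    False :=
  h.false_of_norm_ratTwistedSymbolSum_pow_eq_inv hα hbd hteich hχe (by omega) hu hκ' heven' hord'
    (mul_lt_sub_two_mul_totient_succ h3 hk2) hval'

end TwoLevels

end Summit.BirchSwinnertonDyer.Rank1Residual.Additive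

end
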